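import Summits.QuantumFields.BalabanUV.Beta.FP.TorusCompositeVertexJunction
import Summits.QuantumFields.BalabanUV.Beta.CompositeVertexKernelBoundsTwo

/-!
# `BalabanUV.Beta.FP.TorusCompositeVertexJunctionTwo` — road «FP» for binder row D1, ROUTE T: **F4₂ — THE ORDER-2 (C1) Q-JUNCTION FOR THE BRICKS OF RECORD,
# END TO END: OUR composite second-order insertion jet `compIns₂₂ Lc M lev rs n h h′` IS, ENTRYWISE on the (multiplier, field) slots and for boxes beyond the
# window guard, the torus insertion of the row's PACKED COMPOSITE SECOND-ORDER FAMILY `u_n • compVh2S ℓ_n 𝓋_n 𝓋₂_n Lc n` over an1's ROOTED bricks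
# `ℓ_n m := linKerAt (toSite (rs (n − m))) Lc`, `𝓋_n m := vhKerAt (toSite (rs (n − m))) Lc`, `𝓋₂_n m := ½ (vh2KerAt (toSite (rs (n − m))) Lc · g g₁ g₂ + · g g₂ g₁)`
# (the chain rule's symmetrised second table), unit `u_n = (∏_{i<n} stepScale d Lc (lev (i+1))) · #box^n`** — the order-2 twin of R-16 (leaf-02 g29 W-7 ∕ an2 g50 W-6:
# R-14 §2 ∘ R-13 `pairing₂_of_kernel_succ` ∘ R-15 ∘ R-16 `kernelFunctional_spec` ∘ an2's F5 `compVH2Ker_succ` + `compVH2Ker_congr` + the unit `ring`).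

WHAT.  §1 plumbing; §2 **`kernelFunctional₂_spec`**: a PAIR of functionals `𝓘₁, 𝓘₂` satisfying R-7's and R-8's successor clauses (by `rfl` — both are DEFINED
by those recursions, `𝓘₁` being R-16's) whose order-2 member is, at every depth `n`, every `lev` and every in-box `rs`, the bi-pairing against an2's
`compVH2Ker ℓ_n 𝓋_n 𝓋₂_n Lc n` with unit `u_n`; §3 **`sum_sum_mul_tsum₂_compVh2S_eq_compIns₂₂_apply`** (all pairs of copies load — every box) and
**`perZ_dper_compVh2S_eq_compIns₂₂_apply_single_of_lt`** (the one-pair socket = #41d ∕ #42a's `hQF₂` at the row's family, for boxes with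
`wid Lc n + |u i − u′ i| < T i`).  [folklore] BY NAME; no `def`, nothing cited, 0 sorry; NO chart; nothing of Bałaban's asserted — that this packed family IS the
dressed chart's second vertex through the corrector is an2's (C1) TABLE word (R-D1-g42-4); units per W-4 (2) (an2 A-2 ADOPTED).

HONEST DEPENDENCY (page 1, mandatory): continuum YM on T⁴ ⇐ BetaPertH ∧ nine spine estimates (0/9 proved); BetaPertH ⇐ (D1) ∧ (D4) ∧ CAP+tail;
G-an2-4 gates asym, D1 and NE2/3/4.  HONEST FRAMING (cell contract, verbatim): «discharging `BetaPertH` makes Bałaban's UV stability UNCONDITIONAL —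
a real constructive-QFT result; it is NOT the continuum limit and NOT the Clay problem.»  ABSOLUTE RULE (cell charter, verbatim): «No internally-minted
statement may enter as a cited fact. Every hypothesis is either kernel-proved in this package or a verbatim quotation of a PUBLISHED theorem with page
reference. The manuscript(s) under audit are NOT citable for their own disputed steps — they are the thing under adjudication; programme-internal
(2001/route/tribunal) claims are never citable.»  0 estimates; 0∕4 row-D1 binders (hW, hR, D1Tel, D1Rep); NOT (T-ID), NOT (C1), NOT SDF, NOT D1,
NOT BetaPertH, NOT continuum, NOT Clay.  D1 formalisation swarm LEAF PROVER 02 (b2b-balaban-beta-d1-formalise-leaf-02 gen 29), 2026-08-23.  No existing file touched.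
-/

noncomputable section

open scoped BigOperators

namespace Summit.QuantumFields.BalabanUV.Beta.FP.TorusCompositeVertexJunctionTwo

open Finset
open Literature.MathematicalPhysics.QuantumFieldTheory
open Literature.MathematicalPhysics.QuantumFieldTheory.Balaban1983to89
open Literature.MathematicalPhysics.QuantumFieldTheory.Balaban1983to89.Beta
open B6Lemma24Torus (pbox)
open B4TorusKernel.MultiPeriod (translate)
open ExpKernelCalculus (MKer shiftK)
open AffineAveraging (Site Form1 box toSite)
open AveragingContoursRooted (linAvgAt)
open AveragingHessianKernels (Bond Near packVH)
open AveragingHessianKernelsRooted (linKerAt vhKerAt vhKerAt_eq_zero_left vhKerAt_eq_zero_right linKerAt_eq_zero linKerAt_add vhKerAt_add)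
open AveragingMixedJetTables (vh2KerAt vh2KerAt_add)
open OneStepResolventKernel (Fib)
open Summit.QuantumFields.BalabanUV.Beta.BorderedHessian (stepScale)
open Summit.QuantumFields.BalabanUV.Beta.FP.KernelPeriodisationFib (perZ)
open Summit.QuantumFields.BalabanUV.Beta.FP.KernelPeriodisationFibLoc (dper)
open Summit.QuantumFields.BalabanUV.Beta.FP.TorusGaugeCovariancePairing (wrapPt)
open Summit.QuantumFields.BalabanUV.Beta.FP.TorusCompositeObjects (towerTorus)
open Summit.QuantumFields.BalabanUV.Beta.FP.PeriodisedBorderWardContactTwo (vh2KerAt_eq_zero_of_not_near)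
open Summit.QuantumFields.BalabanUV.Beta.CompositeAveragingCoarseExact (compLinAvgAt)
open Summit.QuantumFields.BalabanUV.Beta.FP.TorusCompositeCovarianceOne (prod_stepScale_mul_card_ne_zero')
open Summit.QuantumFields.BalabanUV.Beta.FP.TorusCompositeCovarianceTwo (card_box_cast)
open Summit.QuantumFields.BalabanUV.Beta.FP.TorusCompositeCovarianceTwoPolar (compIns₂₂)
open Summit.QuantumFields.BalabanUV.Beta.CompositeVertexKernelRec (offs near_iff_exists_offs winF wid mem_winF_iff compLinKer compVHKer compVH2Ker compVh2S
  compLinKer_zero compLinKer_succ compVH2Ker_zero compVH2Ker_succ compLinKer_eq_zero compVHKer_eq_zero_left compVHKer_eq_zero_right compVH2Ker_eq_zero_fluct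
  compVH2Ker_eq_zero_left compVH2Ker_eq_zero_right compLinKer_congr compVHKer_congr compVH2Ker_congr compVh2S_translate)
open Summit.QuantumFields.BalabanUV.Beta.FP.CompositeKernelFunctionalStep (tsum_sum_eq_finset_sum pairing₂_of_kernel_succ)
open Summit.QuantumFields.BalabanUV.Beta.FP.CompositeLinearKernelExpansion (linAvgAt_eq_pow_mul_window_sum compLinAvgAt_eq_pow_mul_tsum)
open Summit.QuantumFields.BalabanUV.Beta.FP.TorusCompositeInsertionKernelPacked (sum_sum_mul_tsum₂_packVH_eq_compIns₂₂_apply perZ_dper_packVH_eq_compIns₂₂_apply_single_of_diam)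
open Summit.QuantumFields.BalabanUV.Beta.FP.TorusCompositeVertexJunction (mul_pairing_eq not_near_of_not_mem_window sum_window_eq sigma_eq kernelFunctional_spec)

variable {d : ℕ} (Lc : ℕ) [NeZero Lc]

/-! ## §1 Plumbing -/

omit [NeZero Lc] in
/-- [folklore] a scalar moves inside the two-background-bond border pairing. -/
theorem mul_pairing₂_eq (c : ℝ) (K : Bond (d + 1) → Bond (d + 1) → Bond (d + 1) → ℝ) (B H' H : Form1 (d + 1) ℝ) :
    c * (∑' u : Site (d + 1), ∑ κ : Fin (d + 1), (∑' u' : Site (d + 1), ∑ κ' : Fin (d + 1), (∑' z : Site (d + 1), ∑ l : Fin (d + 1),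
        K (l, z) (κ, u) (κ', u') * B l z) * H' κ' u') * H κ u)
      = ∑' u : Site (d + 1), ∑ κ : Fin (d + 1), (∑' u' : Site (d + 1), ∑ κ' : Fin (d + 1), (∑' z : Site (d + 1), ∑ l : Fin (d + 1),
          (c * K (l, z) (κ, u) (κ', u')) * B l z) * H' κ' u') * H κ u := by
  rw [← tsum_mul_left]
  refine tsum_congr fun u => ?_
  rw [Finset.mul_sum]
  refine Finset.sum_congr rfl fun κ _ => ?_
  rw [← mul_assoc]
  exact congrArg (fun t : ℝ => t * H κ u) (mul_pairing_eq c (fun f f' => K f (κ, u) f') B H')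

omit [NeZero Lc] in
/-- [folklore] four summands, the middle two traded. -/
theorem add4_eq {a b c e a' A B e' θ : ℝ} (h1 : a = a') (h2 : b = θ * B) (h3 : c = θ * A) (h4 : e = e') :
    a + b + c + e = a' + θ * (A + B) + e' := by
  rw [h1, h2, h3, h4]; ring

omit [NeZero Lc] in
/-- [folklore] two sites of one scale-`N` window of width `W` are within `W` of each other in every direction. -/
theorem abs_sub_le_of_mem_winF {N W : ℕ} {y v v' : Site (d + 1)} (hv : v ∈ winF N W y) (hv' : v' ∈ winF N W y) (i : Fin (d + 1)) :
    |v i - v' i| ≤ (W : ℤ) := by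
  have h1 := (mem_winF_iff.1 hv) i
  have h2 := (mem_winF_iff.1 hv') i
  exact abs_sub_le_iff.2 ⟨by omega, by omega⟩

/-! ## §2 The pair of kernel functionals of the bricks of record -/

/-- [folklore] **`kernelFunctional₂_spec` — FUNCTIONALS `𝓘₁, 𝓘₂` SATISFYING R-7's AND R-8's CHAIN RULES (`h0₁ ∕ hsucc₁ ∕ h0₂ ∕ hsucc₂`, by `rfl`: both are DEFINED by
those recursions, `𝓘₁` being R-16's) WHOSE ORDER-2 MEMBER IS, AT EVERY DEPTH `n`, EVERY `lev` AND EVERY IN-BOX `rs`, THE BI-PAIRING AGAINST an2's COMPOSITE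
SECOND-ORDER KERNEL `compVH2Ker ℓ_n 𝓋_n 𝓋₂_n Lc n` OVER THE ROOTED BRICKS (symmetrised second table) with unit `u_n`** (induction on `n`: R-13 `pairing₂_of_kernel_succ`
read backwards at an2's TOP PEEL `compVH2Ker_succ`; `𝓘₁` below the top in kernel form by R-16; R-15 for `hAf ∕ hCf`; an2's `compVH2Ker_congr` for the brick lists
`rs (n+1−m)` vs `rs (n−m+1)` below the top; the units `θ_n σ_n⁻¹ · σ_n³ = θ_n · σ_n² = stepScale (lev 1) · Lc^(d+1) · σ_n = u_(n+1)`, `σ_n = S′_n (Lc^(d+1))^n`). -/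
theorem kernelFunctional₂_spec :
    ∃ (𝓘₁ : (ℕ → ℕ) → (ℕ → (Fin (d + 1) → ℕ)) → ℕ → Form1 (d + 1) ℝ → Form1 (d + 1) ℝ → Form1 (d + 1) ℝ)
      (𝓘₂ : (ℕ → ℕ) → (ℕ → (Fin (d + 1) → ℕ)) → ℕ → Form1 (d + 1) ℝ → Form1 (d + 1) ℝ → Form1 (d + 1) ℝ → Form1 (d + 1) ℝ),
      (∀ (lev : ℕ → ℕ) (rs : ℕ → (Fin (d + 1) → ℕ)) (H B : Form1 (d + 1) ℝ), 𝓘₁ lev rs 0 H B = 0) ∧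
      (∀ (lev : ℕ → ℕ) (rs : ℕ → (Fin (d + 1) → ℕ)) (n : ℕ) (H B : Form1 (d + 1) ℝ) (κ : Fin (d + 1)) (x : Site (d + 1)),
        𝓘₁ lev rs (n + 1) H B κ x
          = (((Lc : ℝ) ^ (d + 1) * stepScale d Lc (lev 1)) * (∏ i ∈ Finset.range n, (stepScale d Lc (lev (i + 1 + 1)) * ((box (d + 1) Lc).card : ℝ)))⁻¹) *
              (∑' u : Site (d + 1), ∑ κ' : Fin (d + 1),
                (∑' z : Site (d + 1), ∑ l : Fin (d + 1), vhKerAt (toSite (rs 1)) Lc κ x (l, z) (κ', u) *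
                  ((∏ i ∈ Finset.range n, stepScale d Lc (lev (i + 1 + 1))) * compLinAvgAt (fun i => rs (n - i + 1)) Lc n B l z)) *
                ((∏ i ∈ Finset.range n, stepScale d Lc (lev (i + 1 + 1))) * compLinAvgAt (fun i => rs (n - i + 1)) Lc n H κ' u))
            + stepScale d Lc (lev 1) * linAvgAt (toSite (rs 1)) (𝓘₁ (fun k => lev (k + 1)) (fun k => rs (k + 1)) n H B) Lc κ x) ∧
      (∀ (lev : ℕ → ℕ) (rs : ℕ → (Fin (d + 1) → ℕ)) (H H' B : Form1 (d + 1) ℝ), 𝓘₂ lev rs 0 H H' B = 0) ∧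
      (∀ (lev : ℕ → ℕ) (rs : ℕ → (Fin (d + 1) → ℕ)) (n : ℕ) (H H' B : Form1 (d + 1) ℝ) (κ₀ : Fin (d + 1)) (x : Site (d + 1)),
        𝓘₂ lev rs (n + 1) H H' B κ₀ x
          = ((((Lc : ℝ) ^ (d + 1) * stepScale d Lc (lev 1)) * (∏ i ∈ Finset.range n, (stepScale d Lc (lev (i + 1 + 1)) * ((box (d + 1) Lc).card : ℝ)))⁻¹) * (∏ i ∈ Finset.range n, (stepScale d Lc (lev (i + 1 + 1)) * ((box (d + 1) Lc).card : ℝ)))⁻¹) *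
            (∑' u : Site (d + 1), ∑ κ : Fin (d + 1), (∑' u' : Site (d + 1), ∑ κ' : Fin (d + 1),
              (∑' z : Site (d + 1), ∑ l : Fin (d + 1),
                (1 / 2 : ℝ) * (vh2KerAt (toSite (rs 1)) Lc κ₀ x (l, z) (κ, u) (κ', u') + vh2KerAt (toSite (rs 1)) Lc κ₀ x (l, z) (κ', u') (κ, u)) *
                  ((∏ i ∈ Finset.range n, stepScale d Lc (lev (i + 1 + 1))) * compLinAvgAt (fun i => rs (n - i + 1)) Lc n B l z)) *
              ((∏ i ∈ Finset.range n, stepScale d Lc (lev (i + 1 + 1))) * compLinAvgAt (fun i => rs (n - i + 1)) Lc n H' κ' u')) *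
              ((∏ i ∈ Finset.range n, stepScale d Lc (lev (i + 1 + 1))) * compLinAvgAt (fun i => rs (n - i + 1)) Lc n H κ u))
          + (((Lc : ℝ) ^ (d + 1) * stepScale d Lc (lev 1)) * (∏ i ∈ Finset.range n, (stepScale d Lc (lev (i + 1 + 1)) * ((box (d + 1) Lc).card : ℝ)))⁻¹) *
            ((∑' u : Site (d + 1), ∑ κ' : Fin (d + 1),
              (∑' z : Site (d + 1), ∑ l : Fin (d + 1), vhKerAt (toSite (rs 1)) Lc κ₀ x (l, z) (κ', u) * 𝓘₁ (fun k => lev (k + 1)) (fun k => rs (k + 1)) n H' B l z) *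
                ((∏ i ∈ Finset.range n, stepScale d Lc (lev (i + 1 + 1))) * compLinAvgAt (fun i => rs (n - i + 1)) Lc n H κ' u))
            + (∑' u : Site (d + 1), ∑ κ' : Fin (d + 1),
              (∑' z : Site (d + 1), ∑ l : Fin (d + 1), vhKerAt (toSite (rs 1)) Lc κ₀ x (l, z) (κ', u) * 𝓘₁ (fun k => lev (k + 1)) (fun k => rs (k + 1)) n H B l z) *
                ((∏ i ∈ Finset.range n, stepScale d Lc (lev (i + 1 + 1))) * compLinAvgAt (fun i => rs (n - i + 1)) Lc n H' κ' u)))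
          + stepScale d Lc (lev 1) * linAvgAt (toSite (rs 1)) (𝓘₂ (fun k => lev (k + 1)) (fun k => rs (k + 1)) n H H' B) Lc κ₀ x) ∧
      (∀ (n : ℕ) (lev : ℕ → ℕ) (rs : ℕ → (Fin (d + 1) → ℕ)), (∀ k, rs k ∈ box (d + 1) Lc) →
        ∀ (H H' B : Form1 (d + 1) ℝ) (κ₀ : Fin (d + 1)) (x : Site (d + 1)), 𝓘₂ lev rs n H H' B κ₀ x
          = ((∏ i ∈ range n, stepScale d Lc (lev (i + 1))) * ((box (d + 1) Lc).card : ℝ) ^ n) *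
            ∑' u : Site (d + 1), ∑ κ : Fin (d + 1), (∑' u' : Site (d + 1), ∑ κ' : Fin (d + 1), (∑' z : Site (d + 1), ∑ l : Fin (d + 1),
              compVH2Ker (fun m => linKerAt (toSite (rs (n - m))) Lc) (fun m => vhKerAt (toSite (rs (n - m))) Lc)
                (fun m μ y g g₁ g₂ => (1 / 2 : ℝ) * (vh2KerAt (toSite (rs (n - m))) Lc μ y g g₁ g₂ + vh2KerAt (toSite (rs (n - m))) Lc μ y g g₂ g₁)) Lc n κ₀ x (l, z) (κ, u) (κ', u') * B l z) * H' κ' u') * H κ u) := by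
  classical
  have hLc : 1 ≤ Lc := Nat.one_le_iff_ne_zero.mpr (NeZero.ne Lc)
  obtain ⟨𝓘₁, h0₁, hsucc₁, h𝓘₁⟩ := kernelFunctional_spec (d := d) Lc
  -- R-8's step, abstracted once (`S₂ n ih lev rs H H' B κ₀ x` = the `hsucc₂` right-hand side with `ih` for the lower order-2 functional)
  obtain ⟨S₂, hS₂⟩ : ∃ S₂ : ℕ → ((ℕ → ℕ) → (ℕ → (Fin (d + 1) → ℕ)) → Form1 (d + 1) ℝ → Form1 (d + 1) ℝ → Form1 (d + 1) ℝ → Form1 (d + 1) ℝ) → (ℕ → ℕ) → (ℕ → (Fin (d + 1) → ℕ)) → Form1 (d + 1) ℝ → Form1 (d + 1) ℝ → Form1 (d + 1) ℝ → Form1 (d + 1) ℝ,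
      ∀ (n : ℕ) (ih : (ℕ → ℕ) → (ℕ → (Fin (d + 1) → ℕ)) → Form1 (d + 1) ℝ → Form1 (d + 1) ℝ → Form1 (d + 1) ℝ → Form1 (d + 1) ℝ)
        (lev : ℕ → ℕ) (rs : ℕ → (Fin (d + 1) → ℕ)) (H H' B : Form1 (d + 1) ℝ) (κ₀ : Fin (d + 1)) (x : Site (d + 1)),
        S₂ n ih lev rs H H' B κ₀ x
          = ((((Lc : ℝ) ^ (d + 1) * stepScale d Lc (lev 1)) * (∏ i ∈ Finset.range n, (stepScale d Lc (lev (i + 1 + 1)) * ((box (d + 1) Lc).card : ℝ)))⁻¹) * (∏ i ∈ Finset.range n, (stepScale d Lc (lev (i + 1 + 1)) * ((box (d + 1) Lc).card : ℝ)))⁻¹) *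
            (∑' u : Site (d + 1), ∑ κ : Fin (d + 1), (∑' u' : Site (d + 1), ∑ κ' : Fin (d + 1),
              (∑' z : Site (d + 1), ∑ l : Fin (d + 1),
                (1 / 2 : ℝ) * (vh2KerAt (toSite (rs 1)) Lc κ₀ x (l, z) (κ, u) (κ', u') + vh2KerAt (toSite (rs 1)) Lc κ₀ x (l, z) (κ', u') (κ, u)) *
                  ((∏ i ∈ Finset.range n, stepScale d Lc (lev (i + 1 + 1))) * compLinAvgAt (fun i => rs (n - i + 1)) Lc n B l z)) *
              ((∏ i ∈ Finset.range n, stepScale d Lc (lev (i + 1 + 1))) * compLinAvgAt (fun i => rs (n - i + 1)) Lc n H' κ' u')) *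
              ((∏ i ∈ Finset.range n, stepScale d Lc (lev (i + 1 + 1))) * compLinAvgAt (fun i => rs (n - i + 1)) Lc n H κ u))
          + (((Lc : ℝ) ^ (d + 1) * stepScale d Lc (lev 1)) * (∏ i ∈ Finset.range n, (stepScale d Lc (lev (i + 1 + 1)) * ((box (d + 1) Lc).card : ℝ)))⁻¹) *
            ((∑' u : Site (d + 1), ∑ κ' : Fin (d + 1),
              (∑' z : Site (d + 1), ∑ l : Fin (d + 1), vhKerAt (toSite (rs 1)) Lc κ₀ x (l, z) (κ', u) * 𝓘₁ (fun k => lev (k + 1)) (fun k => rs (k + 1)) n H' B l z) *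
                ((∏ i ∈ Finset.range n, stepScale d Lc (lev (i + 1 + 1))) * compLinAvgAt (fun i => rs (n - i + 1)) Lc n H κ' u))
            + (∑' u : Site (d + 1), ∑ κ' : Fin (d + 1),
              (∑' z : Site (d + 1), ∑ l : Fin (d + 1), vhKerAt (toSite (rs 1)) Lc κ₀ x (l, z) (κ', u) * 𝓘₁ (fun k => lev (k + 1)) (fun k => rs (k + 1)) n H B l z) *
                ((∏ i ∈ Finset.range n, stepScale d Lc (lev (i + 1 + 1))) * compLinAvgAt (fun i => rs (n - i + 1)) Lc n H' κ' u)))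
          + stepScale d Lc (lev 1) * linAvgAt (toSite (rs 1)) (ih (fun k => lev (k + 1)) (fun k => rs (k + 1)) H H' B) Lc κ₀ x :=
    ⟨_, fun _ _ _ _ _ _ _ _ _ => rfl⟩
  refine ⟨𝓘₁, fun lev rs N H H' B => Nat.rec (motive := (fun _ => (ℕ → ℕ) → (ℕ → (Fin (d + 1) → ℕ)) → Form1 (d + 1) ℝ → Form1 (d + 1) ℝ → Form1 (d + 1) ℝ → Form1 (d + 1) ℝ)) (fun _ _ _ _ _ => 0) S₂ N lev rs H H' B, h0₁, hsucc₁,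
    fun _ _ _ _ _ => rfl, fun lev rs n H H' B κ₀ x => hS₂ n _ lev rs H H' B κ₀ x, ?_⟩
  intro n
  induction n with
  | zero =>
      intro lev rs _ H H' B κ₀ x
      simp only [Nat.rec_zero, Pi.zero_apply, compVH2Ker_zero, zero_mul, Finset.sum_const_zero, tsum_zero, mul_zero]
  | succ n ih =>
      intro lev rs hrs H H' B κ₀ x
      -- the lower functionals in kernel form (bricks `rs (n − m + 1)`): order 2 by induction, order 1 by R-16
      have hih₂ : ∀ H H' B : Form1 (d + 1) ℝ,
          (Nat.rec (motive := (fun _ => (ℕ → ℕ) → (ℕ → (Fin (d + 1) → ℕ)) → Form1 (d + 1) ℝ → Form1 (d + 1) ℝ → Form1 (d + 1) ℝ → Form1 (d + 1) ℝ)) (fun _ _ _ _ _ => 0) S₂ n (fun k => lev (k + 1)) (fun k => rs (k + 1)) H H' B : Form1 (d + 1) ℝ)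
            = fun κ₁ y => ((∏ i ∈ range n, stepScale d Lc (lev (i + 1 + 1))) * ((box (d + 1) Lc).card : ℝ) ^ n) *
                ∑' u : Site (d + 1), ∑ κ : Fin (d + 1), (∑' u' : Site (d + 1), ∑ κ' : Fin (d + 1), (∑' z : Site (d + 1), ∑ l : Fin (d + 1),
              compVH2Ker (fun m => linKerAt (toSite (rs (n - m + 1))) Lc) (fun m => vhKerAt (toSite (rs (n - m + 1))) Lc)
                  (fun m μ y g g₁ g₂ => (1 / 2 : ℝ) * (vh2KerAt (toSite (rs (n - m + 1))) Lc μ y g g₁ g₂ + vh2KerAt (toSite (rs (n - m + 1))) Lc μ y g g₂ g₁)) Lc n κ₁ y (l, z) (κ, u) (κ', u') * B l z) * H' κ' u') * H κ u :=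
        fun H H' B => funext fun κ₁ => funext fun y => ih (fun k => lev (k + 1)) (fun k => rs (k + 1)) (fun k => hrs (k + 1)) H H' B κ₁ y
      have hih₁ : ∀ H B : Form1 (d + 1) ℝ, 𝓘₁ (fun k => lev (k + 1)) (fun k => rs (k + 1)) n H B
            = fun κ₁ y => ((∏ i ∈ range n, stepScale d Lc (lev (i + 1 + 1))) * ((box (d + 1) Lc).card : ℝ) ^ n) * ∑' u : Site (d + 1), ∑ κ' : Fin (d + 1), (∑' z : Site (d + 1), ∑ l : Fin (d + 1), compVHKer (fun m => linKerAt (toSite (rs (n - m + 1))) Lc) (fun m => vhKerAt (toSite (rs (n - m + 1))) Lc) Lc n κ₁ y (l, z) (κ', u) * B l z) * H κ' u :=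
        fun H B => funext fun κ₁ => funext fun y => h𝓘₁ n (fun k => lev (k + 1)) (fun k => rs (k + 1)) (fun k => hrs (k + 1)) H B κ₁ y
      -- units
      have hu : (∏ i ∈ range (n + 1), stepScale d Lc (lev (i + 1))) * ((box (d + 1) Lc).card : ℝ) ^ (n + 1)
          = stepScale d Lc (lev 1) * (∏ i ∈ range n, stepScale d Lc (lev (i + 1 + 1))) * ((box (d + 1) Lc).card : ℝ) ^ n * ((box (d + 1) Lc).card : ℝ) := by
        simp only [Finset.prod_range_succ', Nat.zero_add, pow_succ]; ring
      have h0' : ((∏ i ∈ range n, stepScale d Lc (lev (i + 1 + 1))) * ((Lc : ℝ) ^ (d + 1)) ^ n) ≠ 0 := by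
        rw [← card_box_cast Lc, ← sigma_eq Lc lev n]
        exact prod_stepScale_mul_card_ne_zero' Lc ⟨rs 0, hrs 0⟩ (fun i => lev (i + 1 + 1)) n
      have hθ : ((Lc : ℝ) ^ (d + 1) * stepScale d Lc (lev 1) * ((∏ i ∈ range n, stepScale d Lc (lev (i + 1 + 1))) * ((Lc : ℝ) ^ (d + 1)) ^ n)⁻¹) * (((∏ i ∈ range n, stepScale d Lc (lev (i + 1 + 1))) * ((Lc : ℝ) ^ (d + 1)) ^ n) * ((∏ i ∈ range n, stepScale d Lc (lev (i + 1 + 1))) * ((Lc : ℝ) ^ (d + 1)) ^ n)) = (stepScale d Lc (lev 1) * (∏ i ∈ range n, stepScale d Lc (lev (i + 1 + 1))) * ((Lc : ℝ) ^ (d + 1)) ^ n * (Lc : ℝ) ^ (d + 1)) := by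
        rw [mul_assoc ((Lc : ℝ) ^ (d + 1) * stepScale d Lc (lev 1)), inv_mul_cancel_left₀ h0']; ring
      have hθ₂ : ((Lc : ℝ) ^ (d + 1) * stepScale d Lc (lev 1) * ((∏ i ∈ range n, stepScale d Lc (lev (i + 1 + 1))) * ((Lc : ℝ) ^ (d + 1)) ^ n)⁻¹ * ((∏ i ∈ range n, stepScale d Lc (lev (i + 1 + 1))) * ((Lc : ℝ) ^ (d + 1)) ^ n)⁻¹)
            * (((∏ i ∈ range n, stepScale d Lc (lev (i + 1 + 1))) * ((Lc : ℝ) ^ (d + 1)) ^ n) * (((∏ i ∈ range n, stepScale d Lc (lev (i + 1 + 1))) * ((Lc : ℝ) ^ (d + 1)) ^ n) * ((∏ i ∈ range n, stepScale d Lc (lev (i + 1 + 1))) * ((Lc : ℝ) ^ (d + 1)) ^ n))) = (stepScale d Lc (lev 1) * (∏ i ∈ range n, stepScale d Lc (lev (i + 1 + 1))) * ((Lc : ℝ) ^ (d + 1)) ^ n * (Lc : ℝ) ^ (d + 1)) := by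
        rw [show ((Lc : ℝ) ^ (d + 1) * stepScale d Lc (lev 1) * ((∏ i ∈ range n, stepScale d Lc (lev (i + 1 + 1))) * ((Lc : ℝ) ^ (d + 1)) ^ n)⁻¹ * ((∏ i ∈ range n, stepScale d Lc (lev (i + 1 + 1))) * ((Lc : ℝ) ^ (d + 1)) ^ n)⁻¹)
            * (((∏ i ∈ range n, stepScale d Lc (lev (i + 1 + 1))) * ((Lc : ℝ) ^ (d + 1)) ^ n) * (((∏ i ∈ range n, stepScale d Lc (lev (i + 1 + 1))) * ((Lc : ℝ) ^ (d + 1)) ^ n) * ((∏ i ∈ range n, stepScale d Lc (lev (i + 1 + 1))) * ((Lc : ℝ) ^ (d + 1)) ^ n)))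
            = (Lc : ℝ) ^ (d + 1) * stepScale d Lc (lev 1) * (((∏ i ∈ range n, stepScale d Lc (lev (i + 1 + 1))) * ((Lc : ℝ) ^ (d + 1)) ^ n)⁻¹ * ((∏ i ∈ range n, stepScale d Lc (lev (i + 1 + 1))) * ((Lc : ℝ) ^ (d + 1)) ^ n))
              * (((∏ i ∈ range n, stepScale d Lc (lev (i + 1 + 1))) * ((Lc : ℝ) ^ (d + 1)) ^ n)⁻¹ * ((∏ i ∈ range n, stepScale d Lc (lev (i + 1 + 1))) * ((Lc : ℝ) ^ (d + 1)) ^ n)) * ((∏ i ∈ range n, stepScale d Lc (lev (i + 1 + 1))) * ((Lc : ℝ) ^ (d + 1)) ^ n) by ring,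
          inv_mul_cancel₀ h0', mul_one, mul_one]; ring
      -- an2's congruences: below the top, the brick lists `rs (n + 1 − m)` and `rs (n − m + 1)` agree
      have hc : ∀ b g : Bond (d + 1), compLinKer (fun m => linKerAt (toSite (rs (n + 1 - m))) Lc) Lc n b g = compLinKer (fun m => linKerAt (toSite (rs (n - m + 1))) Lc) Lc n b g := fun b g =>
        compLinKer_congr n (fun m hm μ y g => by simp only [show n + 1 - m = n - m + 1 by omega]) b g
      have hK : ∀ (μ : Fin (d + 1)) (y : Site (d + 1)) (b b' : Bond (d + 1)), compVHKer (fun m => linKerAt (toSite (rs (n + 1 - m))) Lc) (fun m => vhKerAt (toSite (rs (n + 1 - m))) Lc) Lc n μ y b b'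
            = compVHKer (fun m => linKerAt (toSite (rs (n - m + 1))) Lc) (fun m => vhKerAt (toSite (rs (n - m + 1))) Lc) Lc n μ y b b' :=
        fun μ y b b' => compVHKer_congr n (fun m hm μ y g => by simp only [show n + 1 - m = n - m + 1 by omega])
          (fun m hm μ y g g' => by simp only [show n + 1 - m = n - m + 1 by omega]) μ y b b'
      have hK2 : ∀ (μ : Fin (d + 1)) (y : Site (d + 1)) (f b b' : Bond (d + 1)),
          compVH2Ker (fun m => linKerAt (toSite (rs (n + 1 - m))) Lc) (fun m => vhKerAt (toSite (rs (n + 1 - m))) Lc)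
              (fun m μ y g g₁ g₂ => (1 / 2 : ℝ) * (vh2KerAt (toSite (rs (n + 1 - m))) Lc μ y g g₁ g₂ + vh2KerAt (toSite (rs (n + 1 - m))) Lc μ y g g₂ g₁)) Lc n μ y f b b'
            = compVH2Ker (fun m => linKerAt (toSite (rs (n - m + 1))) Lc) (fun m => vhKerAt (toSite (rs (n - m + 1))) Lc)
              (fun m μ y g g₁ g₂ => (1 / 2 : ℝ) * (vh2KerAt (toSite (rs (n - m + 1))) Lc μ y g g₁ g₂ + vh2KerAt (toSite (rs (n - m + 1))) Lc μ y g g₂ g₁)) Lc n μ y f b b' :=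
        fun μ y f b b' => compVH2Ker_congr n (fun m hm μ y g => by simp only [show n + 1 - m = n - m + 1 by omega])
          (fun m hm μ y g g' => by simp only [show n + 1 - m = n - m + 1 by omega])
          (fun m hm μ y g g' g'' => by simp only [show n + 1 - m = n - m + 1 by omega]) μ y f b b'
      -- the bond window of the coarse site `x`
      obtain ⟨P, hP⟩ : ∃ P : Finset (Bond (d + 1)),
          P = ((Finset.univ : Finset (Fin (d + 1))) ×ˢ offs Lc).image (fun p : Fin (d + 1) × Site (d + 1) => ((p.1, (Lc : ℤ) • x + p.2) : Bond (d + 1))) :=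
        ⟨_, rfl⟩
      -- unfold R-8's recursion once, put the three lower functionals in kernel form, normalise the units
      refine (hS₂ n (Nat.rec (motive := (fun _ => (ℕ → ℕ) → (ℕ → (Fin (d + 1) → ℕ)) → Form1 (d + 1) ℝ → Form1 (d + 1) ℝ → Form1 (d + 1) ℝ → Form1 (d + 1) ℝ)) (fun _ _ _ _ _ => 0) S₂ n) lev rs H H' B κ₀ x).trans ?_
      rw [hih₂ H H' B, hih₁ H' B, hih₁ H B, hu, mul_pairing₂_eq (c := stepScale d Lc (lev 1) * (∏ i ∈ range n, stepScale d Lc (lev (i + 1 + 1))) * ((box (d + 1) Lc).card : ℝ) ^ n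
        * ((box (d + 1) Lc).card : ℝ)), sigma_eq Lc lev n, card_box_cast Lc]
      -- R-13's abstract order-2 step, read backwards
      refine (pairing₂_of_kernel_succ P ((Lc : ℝ) ^ (d + 1) * stepScale d Lc (lev 1) * ((∏ i ∈ range n, stepScale d Lc (lev (i + 1 + 1))) * ((Lc : ℝ) ^ (d + 1)) ^ n)⁻¹ * ((∏ i ∈ range n, stepScale d Lc (lev (i + 1 + 1))) * ((Lc : ℝ) ^ (d + 1)) ^ n)⁻¹)
        ((Lc : ℝ) ^ (d + 1) * stepScale d Lc (lev 1) * ((∏ i ∈ range n, stepScale d Lc (lev (i + 1 + 1))) * ((Lc : ℝ) ^ (d + 1)) ^ n)⁻¹) (stepScale d Lc (lev 1)) κ₀ x (vhKerAt (toSite (rs 1)) Lc κ₀ x)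
        (fun g g' hg => hg.elim (fun hg => vhKerAt_eq_zero_left (hrs 1) (not_near_of_not_mem_window Lc x hP hg) g')
          fun hg' => vhKerAt_eq_zero_right (hrs 1) g (not_near_of_not_mem_window Lc x hP hg'))
        (fun g g₁ g₂ => (1 / 2 : ℝ) * (vh2KerAt (toSite (rs 1)) Lc κ₀ x g g₁ g₂ + vh2KerAt (toSite (rs 1)) Lc κ₀ x g g₂ g₁)) (fun g g₁ g₂ hg => ?_)
        (fun g => (Lc : ℝ) ^ (d + 1) * linKerAt (toSite (rs 1)) Lc κ₀ x g)
        (fun g hg => mul_eq_zero_of_right _ (linKerAt_eq_zero (hrs 1) (not_near_of_not_mem_window Lc x hP hg)))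
        (fun F => linAvgAt (toSite (rs 1)) F Lc) (fun F => ?_)
        (fun g f => ((∏ i ∈ range n, stepScale d Lc (lev (i + 1 + 1))) * ((Lc : ℝ) ^ (d + 1)) ^ n) * compLinKer (fun m => linKerAt (toSite (rs (n - m + 1))) Lc) Lc n f g)
        (fun g => winF (Lc ^ n) (wid Lc n) g.2) (fun g m w hw => mul_eq_zero_of_right _ (compLinKer_eq_zero n (f := (m, w)) hw))
        (fun B' => fun l z => (∏ i ∈ range n, stepScale d Lc (lev (i + 1 + 1))) * compLinAvgAt (fun i => rs (n - i + 1)) Lc n B' l z) (fun B' g => ?_)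
        (fun g f f' => ((∏ i ∈ range n, stepScale d Lc (lev (i + 1 + 1))) * ((Lc : ℝ) ^ (d + 1)) ^ n) * compVHKer (fun m => linKerAt (toSite (rs (n - m + 1))) Lc) (fun m => vhKerAt (toSite (rs (n - m + 1))) Lc) Lc n g.1 g.2 f f')
        (fun g => winF (Lc ^ n) (wid Lc n) g.2) (fun g l f' z hz => mul_eq_zero_of_right _ (compVHKer_eq_zero_left n (f := (l, z)) f' hz))
        (fun g f κ' u hu => mul_eq_zero_of_right _ (compVHKer_eq_zero_right n f (f' := (κ', u)) hu))
        (fun H₁ B' => fun κ₁ y => ((∏ i ∈ range n, stepScale d Lc (lev (i + 1 + 1))) * ((Lc : ℝ) ^ (d + 1)) ^ n) * ∑' u : Site (d + 1), ∑ κ' : Fin (d + 1), (∑' z : Site (d + 1), ∑ l : Fin (d + 1), compVHKer (fun m => linKerAt (toSite (rs (n - m + 1))) Lc) (fun m => vhKerAt (toSite (rs (n - m + 1))) Lc) Lc n κ₁ y (l, z) (κ', u) * B' l z) * H₁ κ' u)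
        (fun H₁ B' g => mul_pairing_eq _ (compVHKer (fun m => linKerAt (toSite (rs (n - m + 1))) Lc) (fun m => vhKerAt (toSite (rs (n - m + 1))) Lc) Lc n g.1 g.2) B' H₁)
        (fun g f f₁ f₂ => ((∏ i ∈ range n, stepScale d Lc (lev (i + 1 + 1))) * ((Lc : ℝ) ^ (d + 1)) ^ n) * compVH2Ker (fun m => linKerAt (toSite (rs (n - m + 1))) Lc) (fun m => vhKerAt (toSite (rs (n - m + 1))) Lc)
          (fun m μ y g g₁ g₂ => (1 / 2 : ℝ) * (vh2KerAt (toSite (rs (n - m + 1))) Lc μ y g g₁ g₂ + vh2KerAt (toSite (rs (n - m + 1))) Lc μ y g g₂ g₁)) Lc n g.1 g.2 f f₁ f₂)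
        (fun g => winF (Lc ^ n) (wid Lc n) g.2)
        (fun g l f₁ f₂ z hz => mul_eq_zero_of_right _ (compVH2Ker_eq_zero_fluct n (f := (l, z)) f₁ f₂ hz))
        (fun g f κ₁ f₂ u hu => mul_eq_zero_of_right _ (compVH2Ker_eq_zero_left n f (b := (κ₁, u)) f₂ hu))
        (fun g f f₁ κ₂ u hu => mul_eq_zero_of_right _ (compVH2Ker_eq_zero_right n f f₁ (b' := (κ₂, u)) hu))
        (fun H₁ H₂ B' => fun κ₁ y => ((∏ i ∈ range n, stepScale d Lc (lev (i + 1 + 1))) * ((Lc : ℝ) ^ (d + 1)) ^ n) *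
          ∑' u : Site (d + 1), ∑ κ : Fin (d + 1), (∑' u' : Site (d + 1), ∑ κ' : Fin (d + 1), (∑' z : Site (d + 1), ∑ l : Fin (d + 1),
              compVH2Ker (fun m => linKerAt (toSite (rs (n - m + 1))) Lc) (fun m => vhKerAt (toSite (rs (n - m + 1))) Lc)
              (fun m μ y g g₁ g₂ => (1 / 2 : ℝ) * (vh2KerAt (toSite (rs (n - m + 1))) Lc μ y g g₁ g₂ + vh2KerAt (toSite (rs (n - m + 1))) Lc μ y g g₂ g₁)) Lc n κ₁ y (l, z) (κ, u) (κ', u') * B' l z) * H₂ κ' u') * H₁ κ u)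
        (fun H₁ H₂ B' g => mul_pairing₂_eq _ (compVH2Ker (fun m => linKerAt (toSite (rs (n - m + 1))) Lc) (fun m => vhKerAt (toSite (rs (n - m + 1))) Lc)
          (fun m μ y g g₁ g₂ => (1 / 2 : ℝ) * (vh2KerAt (toSite (rs (n - m + 1))) Lc μ y g g₁ g₂ + vh2KerAt (toSite (rs (n - m + 1))) Lc μ y g g₂ g₁)) Lc n g.1 g.2) B' H₂ H₁)
        (fun f f₁ f₂ => (stepScale d Lc (lev 1) * (∏ i ∈ range n, stepScale d Lc (lev (i + 1 + 1))) * ((Lc : ℝ) ^ (d + 1)) ^ n * (Lc : ℝ) ^ (d + 1))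
          * compVH2Ker (fun m => linKerAt (toSite (rs (n + 1 - m))) Lc) (fun m => vhKerAt (toSite (rs (n + 1 - m))) Lc)
            (fun m μ y g g₁ g₂ => (1 / 2 : ℝ) * (vh2KerAt (toSite (rs (n + 1 - m))) Lc μ y g g₁ g₂ + vh2KerAt (toSite (rs (n + 1 - m))) Lc μ y g g₂ g₁)) Lc (n + 1) κ₀ x f f₁ f₂)
        (fun f f₁ f₂ => ?_) B H' H).symm
      · -- `hvh2`: an1's window for the second table, both orientations
        rcases hg with hg | hg | hg
        · have h1 := not_near_of_not_mem_window Lc x hP hg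
          rw [vh2KerAt_eq_zero_of_not_near (hrs 1) κ₀ x (Or.inl h1), vh2KerAt_eq_zero_of_not_near (hrs 1) κ₀ x (Or.inl h1), add_zero, mul_zero]
        · have h1 := not_near_of_not_mem_window Lc x hP hg
          rw [vh2KerAt_eq_zero_of_not_near (hrs 1) κ₀ x (Or.inr (Or.inl h1)), vh2KerAt_eq_zero_of_not_near (hrs 1) κ₀ x (Or.inr (Or.inr h1)),
            add_zero, mul_zero]
        · have h1 := not_near_of_not_mem_window Lc x hP hg
          rw [vh2KerAt_eq_zero_of_not_near (hrs 1) κ₀ x (Or.inr (Or.inr h1)), vh2KerAt_eq_zero_of_not_near (hrs 1) κ₀ x (Or.inr (Or.inl h1)),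
            add_zero, mul_zero]
      · -- `hAf`: R-15 §1 at the window, read as a bond `tsum`
        have h1 : (∑' x₁ : Site (d + 1), ∑ κ₁ : Fin (d + 1), ((Lc : ℝ) ^ (d + 1) * linKerAt (toSite (rs 1)) Lc κ₀ x (κ₁, x₁)) * F κ₁ x₁)
            = ∑ p ∈ P, ((Lc : ℝ) ^ (d + 1) * linKerAt (toSite (rs 1)) Lc κ₀ x p) * F p.1 p.2 :=
          tsum_sum_eq_finset_sum P (fun g => ((Lc : ℝ) ^ (d + 1) * linKerAt (toSite (rs 1)) Lc κ₀ x g) * F g.1 g.2)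
            fun g hg => mul_eq_zero_of_left (mul_eq_zero_of_right _ (linKerAt_eq_zero (hrs 1) (not_near_of_not_mem_window Lc x hP hg))) _
        rw [h1, sum_window_eq Lc x hP, linAvgAt_eq_pow_mul_window_sum hLc (hrs 1) (offs Lc) (fun y w h => near_iff_exists_offs.1 h) F κ₀ x]
        simp only [Finset.mul_sum, mul_assoc]
      · -- `hCf`: R-15 §2 for the lower storey's bricks
        rw [compLinAvgAt_eq_pow_mul_tsum hLc (fun i => rs (n - i + 1)) (fun k => hrs _) (offs Lc) (fun y w h => near_iff_exists_offs.1 h)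
          (compLinKer (fun m => linKerAt (toSite (rs (n - m + 1))) Lc) Lc) (fun f g => compLinKer_zero f g) (fun m f g => compLinKer_succ m f g)
          (fun m g => winF (Lc ^ m) (wid Lc m) g.2) (fun m f g h => compLinKer_eq_zero m h) n B' g, ← mul_assoc, ← tsum_mul_left]
        refine tsum_congr fun w => ?_
        rw [Finset.mul_sum]
        exact Finset.sum_congr rfl fun m _ => by ring
      · -- `h𝒲′`: an2's four-summand top peel + congruences below the top + the units
        rw [compVH2Ker_succ, Nat.add_sub_cancel_left, mul_add, mul_add, mul_add]
        refine add4_eq ?_ ?_ ?_ ?_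
        · simp only [sum_window_eq Lc x hP, hc, Finset.mul_sum]
          refine Finset.sum_congr rfl fun κ₁ _ => Finset.sum_congr rfl fun e _ => Finset.sum_congr rfl fun κ₂ _ =>
            Finset.sum_congr rfl fun e' _ => Finset.sum_congr rfl fun κ₃ _ => Finset.sum_congr rfl fun e'' _ => ?_
          rw [← hθ₂]; ring
        · simp only [sum_window_eq Lc x hP, hc, hK, Finset.mul_sum]
          refine Finset.sum_congr rfl fun κ₁ _ => Finset.sum_congr rfl fun e _ => Finset.sum_congr rfl fun κ₂ _ =>
            Finset.sum_congr rfl fun e' _ => ?_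
          rw [← hθ]; ring
        · simp only [sum_window_eq Lc x hP, hc, hK, Finset.mul_sum]
          refine Finset.sum_congr rfl fun κ₁ _ => Finset.sum_congr rfl fun e _ => Finset.sum_congr rfl fun κ₂ _ =>
            Finset.sum_congr rfl fun e' _ => ?_
          rw [← hθ]; ring
        · simp only [sum_window_eq Lc x hP, hK2, Finset.mul_sum]
          refine Finset.sum_congr rfl fun κ₁ _ => Finset.sum_congr rfl fun e _ => ?_
          ring

/-! ## §3 F4₂: the order-2 Q-junction for the bricks of record -/

section Junction

variable (n : ℕ) (M : Fin (d + 1) → ℕ) [∀ μ, NeZero (M μ)] (lev : ℕ → ℕ) (rs : ℕ → (Fin (d + 1) → ℕ)) (hrs : ∀ k, rs k ∈ box (d + 1) Lc)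
include hrs

/-- [folklore] **F4₂ — THE (C1) Q-JUNCTION, ORDER 2, ALL PAIRS OF COPIES, EVERY BOX** (R-14 §2 `sum_sum_mul_tsum₂_packVH_eq_compIns₂₂_apply` at
`K₂ := compVH2Ker ℓ_n 𝓋_n 𝓋₂_n Lc n`, `cu := u_n`, `WK := winF (Lc^n) (wid Lc n)`, with `kernelFunctional₂_spec`'s pair and an2's three windows):
`Σ_b Σ_{b′} h b · h′ b′ · Σ'_{m₁ m₂ m} (u_n • compVh2S … n b.2 (b.1 + T m₁) b′.2 (b′.1 + T m₂)) (Lc^n • x̄) (z + T m) (inr κ₀) (inl β) = compIns₂₂ Lc M lev rs n h h′ (x̄, κ₀) (z, β)`. -/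
theorem sum_sum_mul_tsum₂_compVh2S_eq_compIns₂₂_apply
    (h h' : ↥(pbox (towerTorus Lc M n)) × Fin (d + 1) → ℝ) (x : ↥(pbox M)) (κ₀ : Fin (d + 1)) (z : ↥(pbox (towerTorus Lc M n))) (β : Fin (d + 1)) :
    ∑ b : ↥(pbox (towerTorus Lc M n)) × Fin (d + 1), ∑ b' : ↥(pbox (towerTorus Lc M n)) × Fin (d + 1), h b * (h' b' *
        ∑' m₁ : Site (d + 1), ∑' m₂ : Site (d + 1), ∑' m : Site (d + 1),
          (((∏ i ∈ range n, stepScale d Lc (lev (i + 1))) * ((box (d + 1) Lc).card : ℝ) ^ n) •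
            compVh2S (fun m => linKerAt (toSite (rs (n - m))) Lc) (fun m => vhKerAt (toSite (rs (n - m))) Lc)
            (fun m μ y g g₁ g₂ => (1 / 2 : ℝ) * (vh2KerAt (toSite (rs (n - m))) Lc μ y g g₁ g₂ + vh2KerAt (toSite (rs (n - m))) Lc μ y g g₂ g₁)) Lc n b.2 (translate (towerTorus Lc M n) (b.1 : Site (d + 1)) m₁) b'.2
              (translate (towerTorus Lc M n) (b'.1 : Site (d + 1)) m₂))
            ((((Lc ^ n : ℕ) : ℤ)) • (x : Site (d + 1))) (translate (towerTorus Lc M n) (z : Site (d + 1)) m) (Sum.inr κ₀) (Sum.inl β))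
      = compIns₂₂ Lc M lev rs n h h' (x, κ₀) (z, β) := by
  obtain ⟨𝓘₁, 𝓘₂, h0₁, hsucc₁, h0₂, hsucc₂, h𝓘₂⟩ := kernelFunctional₂_spec (d := d) Lc
  exact sum_sum_mul_tsum₂_packVH_eq_compIns₂₂_apply Lc 𝓘₁ h0₁ hsucc₁ 𝓘₂ h0₂ hsucc₂ n M lev rs hrs
    (compVH2Ker (fun m => linKerAt (toSite (rs (n - m))) Lc) (fun m => vhKerAt (toSite (rs (n - m))) Lc)
      (fun m μ y g g₁ g₂ => (1 / 2 : ℝ) * (vh2KerAt (toSite (rs (n - m))) Lc μ y g g₁ g₂ + vh2KerAt (toSite (rs (n - m))) Lc μ y g g₂ g₁)) Lc n)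
    ((∏ i ∈ range n, stepScale d Lc (lev (i + 1))) * ((box (d + 1) Lc).card : ℝ) ^ n) (winF (Lc ^ n) (wid Lc n))
    (fun μ y α f₁ f₂ w hw => compVH2Ker_eq_zero_fluct n (f := (α, w)) f₁ f₂ hw)
    (fun μ y f κ f₂ u hu => compVH2Ker_eq_zero_left n f (b := (κ, u)) f₂ hu)
    (fun μ y f f₁ κ' u' hu' => compVH2Ker_eq_zero_right n f f₁ (b' := (κ', u')) hu')
    (h𝓘₂ n lev rs hrs) h h' x κ₀ z β

/-- [folklore] **F4₂, ONE-PAIR SOCKET = #41d ∕ #42a's `hQF₂` AT THE ROW's FAMILY, FOR BOXES BEYOND THE WINDOW** (R-14 §2 `…_single_of_diam` with `D := wid Lc n`, the window's own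
diameter; block covariance `hWt` by an2's `compVh2S_translate` over an1's `linKerAt_add ∕ vhKerAt_add ∕ vh2KerAt_add`): if `wid Lc n + |u i − u′ i| < T i` in every direction,
`perZ T (dper T (u_n • compVh2S … n κ u κ′ u′)) (Lc^n • x̄) z (inr κ₀) (inl β) = compIns₂₂ Lc M lev rs n 𝟙_((wrapPt T u, κ)) 𝟙_((wrapPt T u′, κ′)) (x̄, κ₀) (z, β)`. -/
theorem perZ_dper_compVh2S_eq_compIns₂₂_apply_single_of_lt
    (κ : Fin (d + 1)) (u : Site (d + 1)) (κ' : Fin (d + 1)) (u' : Site (d + 1))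
    (x : ↥(pbox M)) (κ₀ : Fin (d + 1)) (z : ↥(pbox (towerTorus Lc M n))) (β : Fin (d + 1))
    (hK : ∀ i : Fin (d + 1), (wid Lc n : ℤ) + |u i - u' i| < (towerTorus Lc M n i : ℤ)) :
    perZ (towerTorus Lc M n) (dper (towerTorus Lc M n)
        (((∏ i ∈ range n, stepScale d Lc (lev (i + 1))) * ((box (d + 1) Lc).card : ℝ) ^ n) •
          compVh2S (fun m => linKerAt (toSite (rs (n - m))) Lc) (fun m => vhKerAt (toSite (rs (n - m))) Lc)
            (fun m μ y g g₁ g₂ => (1 / 2 : ℝ) * (vh2KerAt (toSite (rs (n - m))) Lc μ y g g₁ g₂ + vh2KerAt (toSite (rs (n - m))) Lc μ y g g₂ g₁)) Lc n κ u κ' u'))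
        ((((Lc ^ n : ℕ) : ℤ)) • (x : Site (d + 1))) (z : Site (d + 1)) (Sum.inr κ₀) (Sum.inl β)
      = compIns₂₂ Lc M lev rs n (fun b => if b = (wrapPt (towerTorus Lc M n) u, κ) then 1 else 0)
          (fun b => if b = (wrapPt (towerTorus Lc M n) u', κ') then 1 else 0) (x, κ₀) (z, β) := by
  obtain ⟨𝓘₁, 𝓘₂, h0₁, hsucc₁, h0₂, hsucc₂, h𝓘₂⟩ := kernelFunctional₂_spec (d := d) Lc
  have hLc : 1 ≤ Lc := Nat.one_le_iff_ne_zero.mpr (NeZero.ne Lc)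
  exact perZ_dper_packVH_eq_compIns₂₂_apply_single_of_diam Lc 𝓘₁ h0₁ hsucc₁ 𝓘₂ h0₂ hsucc₂ n M lev rs hrs
    (compVH2Ker (fun m => linKerAt (toSite (rs (n - m))) Lc) (fun m => vhKerAt (toSite (rs (n - m))) Lc)
      (fun m μ y g g₁ g₂ => (1 / 2 : ℝ) * (vh2KerAt (toSite (rs (n - m))) Lc μ y g g₁ g₂ + vh2KerAt (toSite (rs (n - m))) Lc μ y g g₂ g₁)) Lc n)
    ((∏ i ∈ range n, stepScale d Lc (lev (i + 1))) * ((box (d + 1) Lc).card : ℝ) ^ n) (winF (Lc ^ n) (wid Lc n))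
    (fun μ y α f₁ f₂ w hw => compVH2Ker_eq_zero_fluct n (f := (α, w)) f₁ f₂ hw)
    (fun μ y f κ f₂ u hu => compVH2Ker_eq_zero_left n f (b := (κ, u)) f₂ hu)
    (fun μ y f f₁ κ' u' hu' => compVH2Ker_eq_zero_right n f f₁ (b' := (κ', u')) hu')
    (fun κ u κ' u' t => compVh2S_translate hLc (fun _ μ y t f => linKerAt_add _ Lc μ y t f) (fun _ μ y t f f' => vhKerAt_add _ Lc μ y t f f')
      (fun _ μ y t g g' g'' => by simp only [vh2KerAt_add]) n κ u κ' u' t)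
    (h𝓘₂ n lev rs hrs) κ u κ' u' x κ₀ z β (wid Lc n : ℤ)
    (fun v hv v' hv' i => abs_sub_le_of_mem_winF hv hv' i) hK

end Junction

end Summit.QuantumFields.BalabanUV.Beta.FP.TorusCompositeVertexJunctionTwo

end
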